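import Summits.MatrixMultiplication.OmegaCensus.DominoZ17StructSixArrC0
import HarnessLib

/-!
# The `y`-arrangement list of family `C` for the structural part-`6` route, `p = 17`: completeness decides, part 6 of 6 (independent of the other parts)

ω-census `pub-omega`, family (b3), seat pub-omega-group gen 25.  Framing: lottery ticket; floor = certified bounds/negative
ranges.  VALUE: per-prime kernel data of the structural part-`6` route WITHOUT the pigeonhole (`DominoZpZpStructSixWide*.lean`)
for `p = 17` — target: the OPEN census cell `(1,6,16)@289` (`A = ℤ₁₇²`) and every larger order with such a quotient; NOT progress on ω.

Per-representative kernel decides `(arr6Y2 17 k).all (· ∈ yscZ17s6)` restricted to `dY6` for 12 representatives.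
-/

namespace Summit.MatrixMultiplication.OmegaCensus

open ZpZpDomino

namespace ZpZpDomino

/-- Completeness at representative 60. [folklore] -/
theorem yscZ17s6_c60 : ((arr6Y2 17 [1,0,0,0,0,0,0,0,0,0,0,0,1,2,1,0,1]).all fun ys => !(dY6 ys) || yscZ17s6.contains ys) = true := by decide +kernel

/-- Completeness at representative 61. [folklore] -/
theorem yscZ17s6_c61 : ((arr6Y2 17 [1,0,0,0,0,0,0,0,0,0,0,0,2,0,1,2,0]).all fun ys => !(dY6 ys) || yscZ17s6.contains ys) = true := by decide +kernel

/-- Completeness at representative 62. [folklore] -/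
theorem yscZ17s6_c62 : ((arr6Y2 17 [1,0,0,0,0,0,0,0,0,0,0,1,0,1,2,0,1]).all fun ys => !(dY6 ys) || yscZ17s6.contains ys) = true := by decide +kernel

/-- Completeness at representative 63. [folklore] -/
theorem yscZ17s6_c63 : ((arr6Y2 17 [1,0,0,0,0,0,0,0,0,0,0,1,2,1,0,0,1]).all fun ys => !(dY6 ys) || yscZ17s6.contains ys) = true := by decide +kernel

/-- Completeness at representative 64. [folklore] -/
theorem yscZ17s6_c64 : ((arr6Y2 17 [1,0,0,0,0,0,0,0,0,0,1,0,0,2,1,0,1]).all fun ys => !(dY6 ys) || yscZ17s6.contains ys) = true := by decide +kernel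

/-- Completeness at representative 65. [folklore] -/
theorem yscZ17s6_c65 : ((arr6Y2 17 [1,0,0,0,0,0,0,0,0,0,1,0,1,1,0,2,0]).all fun ys => !(dY6 ys) || yscZ17s6.contains ys) = true := by decide +kernel

/-- Completeness at representative 66. [folklore] -/
theorem yscZ17s6_c66 : ((arr6Y2 17 [1,0,0,0,0,0,0,1,2,1,0,0,0,0,0,0,1]).all fun ys => !(dY6 ys) || yscZ17s6.contains ys) = true := by decide +kernel

/-- Completeness at representative 67. [folklore] -/
theorem yscZ17s6_c67 : ((arr6Y2 17 [2,0,0,0,0,0,0,0,0,0,0,1,2,0,0,0,1]).all fun ys => !(dY6 ys) || yscZ17s6.contains ys) = true := by decide +kernel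

/-- Completeness at representative 68. [folklore] -/
theorem yscZ17s6_c68 : ((arr6Y2 17 [2,0,0,0,0,0,0,0,2,1,0,0,0,0,0,0,1]).all fun ys => !(dY6 ys) || yscZ17s6.contains ys) = true := by decide +kernel

end ZpZpDomino

end Summit.MatrixMultiplication.OmegaCensus
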